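import Literature.AnabelianGeometry.SemiGraphs.PSCGraphicity
import Literature.AnabelianGeometry.SemiGraphs.Coverticial
import HarnessLib

/-!
# [CombGC] Definition 1.1 (ii) "sturdy" LEVEL-WISE and Remark 1.1.5 (a sturdy characteristic covering) — sub-DAG statements

Mochizuki, *A combinatorial version of the Grothendieck conjecture*, Tohoku Math. J. **59** (2007)
455–479 [CombGC], §1, author's manuscript p. 7 (Definition 1.1 (ii)) and p. 8 (Remark 1.1.5)
[cite: MochizukiCombGC2007, Rmk 1.1.5 p.8].  STATEMENTS-FIRST sub-DAG typing (human ruling D-0068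
(1); cell file `plan/L3/SUBDAG-CombGC-Thm16.md`, row **T16-L07** `SturdyCharacteristicCover`; seat
abc-iut-w5-d188, row named by abc-iut-L3-lead ξ3 2026-08-26T00:47Z; one writer of the sub-DAG rows:
abc-iut-w4-d052) of the input that the proof of Theorem 1.6 (ii) (p. 14: "we may assume, without
loss of generality, that `G`, `H` are noncuspidal and sturdy") and the proof of Proposition 1.2
(p. 9: "under the further assumption that `G` is sturdy [cf. Remark 1.1.5]") draw from Remark 1.1.5:

> Remark 1.1.5 (p. 8): "From the point of view of Definition 1.1, (i), the condition that a semi-graph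
> of anabelioids `G` of PSC-type be sturdy corresponds to the condition that every irreducible
> component of the pointed stable curve that gives rise to `G` be of genus `≥ 2`. [Indeed, this
> follows immediately from the well-known structure of fundamental groups of Riemann surfaces.] In
> particular, one verifies immediately that, even if `G` is not sturdy, there always exists a
> characteristic open subgroup `H ⊆ Π_G` which satisfies the following property: Every `G′` which
> arises as a `Π_G`-covering `G′ → G` such that `Π_{G′} ⊆ H ⊆ Π_G` is sturdy. In fact, [it is a
> routine exercise to show that] one may even bound the index `[Π_G : H]` explicitly in terms of say,
> the rank [over `Ẑ^Σ`] of `M_G`."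

## Rendering (LEVEL-WISE over one `PSCDatum`, as in `PSCSeparatingCoverings.lean` / `PSCGraphicitySub.lean`)

`PSCFundamentalGroup.lean` (abc-iut-L3-t4) types *sturdy* for the datum `G` itself through the
FIRST sentence of Remark 1.1.5 (`PSCDatum.IsSturdy := ∀ v, 2 ≤ G.genus v`), the interface carrying
the genera of the components of `G` but NOT of the components of its finite étale coverings `G_U`
(open `U ≤ Π_G`; no covering datum is constructed — GAP-LEDGER G-w4d052-1 / the F1 design note of
abc-iut-w4-d052).  To state the SECOND sentence ("every `G′` … is sturdy") level-wise we therefore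
render "`G_U` is sturdy" by the paper's own INTRINSIC Definition 1.1 (ii), p. 7: "If one forms the
quotient of `Π_G` by the closed normal subgroup generated by the … edge-like … subgroups, then one
obtains … `Π^unr_G`"; "We shall refer to the images of the verticial … subgroups of `Π_G` in …
`Π^unr_G` … as the … unramified verticial … subgroups. If the abelianization of every unramified
verticial subgroup of `Π^unr_G` is free of rank `≥ 2` over `Ẑ^Σ`, then we shall say that `G` is
sturdy" — with the misprint "rank `≥ 2`" read "rank `> 2`" as corrected in Hoshi–Mochizuki [CbTpII]
Rmk. 1.1.2 (bib `HoshiMochizukiCbTpII2022`; recorded in the docstring of `PSCDatum.IsSturdy`), applied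
to the covering `G_U` (Remark 1.1.1, p. 7: "any connected finite étale covering of a semi-graph of
anabelioids of PSC-type is again a semi-graph of anabelioids of PSC-type"), whose PSC-fundamental group
is `Π_{G_U} = U` and whose edge-like / verticial subgroups are the `U ⊓ γ Π_e γ⁻¹` / `U ⊓ γ Π_v γ⁻¹`
(`IsEdgeLikeIn`, `IsVerticialIn` of `PSCFundamentalGroup.lean`):

* `PSCDatum.unrKerIn U` — `Ker(Π_{G_U} ↠ Π^unr_{G_U})`: the closure of the normal closure IN `U` of the
  edge-like subgroups of `Π_{G_U}` (for `U = Π_G` this is `unrKer`; the one-line identification is left to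
  the proof-only companion);
* `PSCDatum.unrVertAt U A := A ⊔ unrKerIn U` — the inverse image in `U` of the unramified verticial
  subgroup of `Π^unr_{G_U}` that is the image of the verticial subgroup `A` of `Π_{G_U}`; and
  `PSCDatum.unrVertAbKerAt U A` — the inverse image of the closed commutator subgroup of that image, so
  that `unrVertAt U A ⧸ unrVertAbKerAt U A` IS its abelianization;
* `PSCDatum.IsSturdyAt U` — "`G_U` is sturdy" (Def. 1.1 (ii) at the covering): every such abelianization
  is "free of rank `> 2` over `Ẑ^Σ`", rendered — exactly as abc-iut-w4-d052's `AbelianizedGrphRank`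
  renders "free of rank `r` over `Ẑ^Σ`" — as "is the pro-`Σ` completion of `ℤ^r`" through the tree's
  `SemiGraphOfAnabelioids.IsProSigmaCompletion` ([SemiAnbd] Ex. 2.10 interface, `Coverticial.lean`), the
  dense homomorphism being part of the existential and the quotient formed under a displayed normality
  hypothesis (always satisfied), so that no instance is declared;
* `PSCDatum.SturdyAtTopIffSturdy` — Remark 1.1.5, FIRST sentence, as the predicate "`G` is sturdy in the
  sense of Def. 1.1 (ii) iff every component has genus `≥ 2`" (`IsSturdyAt ⊤ ↔ IsSturdy`);
* `PSCDatum.SturdyCharacteristicCover` — Remark 1.1.5, SECOND sentence (row T16-L07);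
* `SturdyCoverHolds Ω` — both, as printed, over the origin parameter `Ω : PSCOrigin` of
  `PSCGraphicity.lean` ("for every `G` of pro-Σ PSC-type").

The parenthetical THIRD sentence (an explicit bound on `[Π_G : H]` in terms of the rank of `M_G`) is not
used by the proofs of Prop. 1.2 / Thm. 1.6 and is not typed -- TODO(general form): Rmk. 1.1.5's index
bound, once the rank of `M_G` over `Ẑ^Σ` has a decl.  These are SUB-NODE STATEMENTS of GEOMETRIC-ORIGIN
content ("the well-known structure of fundamental groups of Riemann surfaces"): predicates ON the datum
plus the `…Holds Ω` bundle; FALSE for arbitrary data satisfying the `PSCDatum` axioms, hence nothing is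
asserted and nothing here is a FACT-LIST fact (post-freeze sub-node target); typed ≠ proved; nothing here
takes a side on [IUTchIII] Cor. 3.12. [cite: MochizukiCombGC2007, Def 1.1(ii) p.7]
-/

namespace Literature.AnabelianGeometry.SemiGraphs

namespace PSCDatum

open SemiGraphOfAnabelioids (IsProSigmaCompletion)

universe u

variable {P : Type u} [Group P] [TopologicalSpace P] [IsTopologicalGroup P]

/-! ### `Π^unr` of a finite étale covering, level-wise (Def. 1.1 (ii), p. 7) -/

/-- **[CombGC] Definition 1.1 (ii)**, p. 7, for the finite étale `Π_G`-covering `G_U → G` attached to an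
open subgroup `U ≤ Π_G` (`Π_{G_U} = U`): the kernel of `Π_{G_U} ↠ Π^unr_{G_U}`, i.e. "the closed normal
subgroup generated by the … edge-like … subgroups" of `Π_{G_U}` — the closure of (the image in `Π_G`
of) the normal closure IN `U` of the edge-like subgroups `U ⊓ γ Π_e γ⁻¹` of `Π_{G_U}` (`IsEdgeLikeIn`).
Recorded, like every level-wise object of `PSCFundamentalGroup.lean`, as a subgroup of `Π_G`; for
`U = Π_G` it is `unrKer`.  Intended for OPEN `U`. [cite: MochizukiCombGC2007, Def 1.1(ii) p.7] -/
def unrKerIn (G : PSCDatum P) (U : Subgroup P) : Subgroup P :=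
  ((Subgroup.normalClosure {x : U | ∃ A : Subgroup P, G.IsEdgeLikeIn U A ∧ (x : P) ∈ A}).map
    U.subtype).topologicalClosure

/-- The inverse image in `Π_{G_U} = U` of the *unramified verticial subgroup* of `Π^unr_{G_U}` that is
the image of the verticial subgroup `A` (`= U ⊓ γ Π_v γ⁻¹`) of `Π_{G_U}` ("the images of the verticial …
subgroups of `Π_G` in … `Π^unr_G`", Def. 1.1 (ii), p. 7, at the covering): `A · Ker(Π_{G_U} ↠ Π^unr_{G_U})`.
[cite: MochizukiCombGC2007, Def 1.1(ii) p.7] -/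
def unrVertAt (G : PSCDatum P) (U A : Subgroup P) : Subgroup P := A ⊔ G.unrKerIn U

/-- The inverse image in `Π_{G_U}` of the closed commutator subgroup of the unramified verticial subgroup
`unrVertAt U A / unrKerIn U` of `Π^unr_{G_U}`, so that `unrVertAt U A ⧸ unrVertAbKerAt U A` is "the
abelianization of [that] unramified verticial subgroup" (Def. 1.1 (ii), p. 7, at the covering).
[cite: MochizukiCombGC2007, Def 1.1(ii) p.7] -/
def unrVertAbKerAt (G : PSCDatum P) (U A : Subgroup P) : Subgroup P :=
  (⁅G.unrVertAt U A, G.unrVertAt U A⁆ ⊔ G.unrKerIn U).topologicalClosure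

/-! ### "Sturdy" for a finite étale covering (Def. 1.1 (ii), p. 7) -/

/-- **[CombGC] Definition 1.1 (ii), "sturdy", for the covering `G_U`** (open `U ≤ Π_G`; Rmk. 1.1.1: a
connected finite étale covering of a semi-graph of anabelioids of PSC-type is again of PSC-type), p. 7:
"If the abelianization of every unramified verticial subgroup of `Π^unr_G` is free of rank `≥ 2` over
`Ẑ^Σ`, then we shall say that `G` is sturdy" — with "`≥ 2`" read "`> 2`" (misprint corrected in
Hoshi–Mochizuki [CbTpII] Rmk. 1.1.2, bib `HoshiMochizukiCbTpII2022`, as recorded at `PSCDatum.IsSturdy`).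
"Free of rank `r` over `Ẑ^Σ`" is rendered "is the pro-`Σ` completion of `ℤ^r`"
(`SemiGraphOfAnabelioids.IsProSigmaCompletion`), the quotient being formed under a displayed normality
hypothesis (always satisfied).  A predicate on the datum; intended for OPEN `U`.
[cite: MochizukiCombGC2007, Def 1.1(ii) p.7] -/
def IsSturdyAt (G : PSCDatum P) (U : Subgroup P) : Prop :=
  ∀ A : Subgroup P, G.IsVerticialIn U A →
    ∀ [((G.unrVertAbKerAt U A).subgroupOf (G.unrVertAt U A)).Normal],
      ∃ r : ℕ, 2 < r ∧
        ∃ ι : Multiplicative (Fin r → ℤ) →*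
            G.unrVertAt U A ⧸ (G.unrVertAbKerAt U A).subgroupOf (G.unrVertAt U A),
          IsProSigmaCompletion G.Sigma ι

/-! ### Remark 1.1.5, p. 8 -/

/-- **[CombGC] Remark 1.1.5, first sentence**, p. 8, as a predicate on the datum: "the condition that a
semi-graph of anabelioids `G` of PSC-type be sturdy corresponds to the condition that every irreducible
component of the pointed stable curve that gives rise to `G` be of genus `≥ 2`. [Indeed, this follows
immediately from the well-known structure of fundamental groups of Riemann surfaces.]" — Def. 1.1 (ii)'s
"sturdy" at the trivial covering `U = Π_G` (`IsSturdyAt ⊤`) iff abc-iut-L3-t4's genus-typed `IsSturdy`.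
Geometric-origin content; not asserted. [cite: MochizukiCombGC2007, Rmk 1.1.5 p.8] -/
def SturdyAtTopIffSturdy (G : PSCDatum P) : Prop :=
  G.IsSturdyAt ⊤ ↔ G.IsSturdy

/-- **[CombGC] Remark 1.1.5, second sentence (sub-DAG row T16-L07 `SturdyCharacteristicCover`)**, p. 8:
"even if `G` is not sturdy, there always exists a characteristic open subgroup `H ⊆ Π_G` which satisfies
the following property: Every `G′` which arises as a `Π_G`-covering `G′ → G` such that
`Π_{G′} ⊆ H ⊆ Π_G` is sturdy."  A predicate on the datum (geometric-origin content: "one verifies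
immediately" from the first sentence and the structure of surface groups); not asserted.  (The
parenthetical third sentence — an explicit bound on `[Π_G : H]` in terms of the rank of `M_G` — is not
typed.) [cite: MochizukiCombGC2007, Rmk 1.1.5 p.8] -/
def SturdyCharacteristicCover (G : PSCDatum P) : Prop :=
  ∃ H : Subgroup P, IsOpen (H : Set P) ∧ H.Characteristic ∧
    ∀ U : Subgroup P, IsOpen (U : Set P) → U ≤ H → G.IsSturdyAt U

/-! ### The printed statement over the origin parameter -/

section Statements

variable (Ω : PSCOrigin.{u})

/-- **[CombGC] Remark 1.1.5 as printed**, for every `G` of pro-Σ PSC-type (origin parameter `Ω` of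
`PSCGraphicity.lean`): Def. 1.1 (ii)'s "sturdy" is "every component has genus `≥ 2`", and a sturdy
characteristic open subgroup exists. [cite: MochizukiCombGC2007, Rmk 1.1.5 p.8] -/
def SturdyCoverHolds : Prop :=
  ∀ ⦃Q : Type u⦄ [Group Q] [TopologicalSpace Q] [IsTopologicalGroup Q] (G : PSCDatum Q),
    Ω.IsOfPSCType G → G.SturdyAtTopIffSturdy ∧ G.SturdyCharacteristicCover

end Statements

end PSCDatum

end Literature.AnabelianGeometry.SemiGraphs
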